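import Summits.QuantumFields.YangMills.Theorems.UnitScaleTiltProp7BlendCells
import HarnessLib

/-!
# Route `UnitScaleTilt`, crux K1 child «MinimiserStabilityRegPr» (stmt-QuantumFields-19200), registered stub `stub_prop7From14` (skeleton birth_v7
# cc37a178…; leaf V3 «Prop 7 from a background (14)») — THE EIGHT COMB ELEMENTS OF A CELL AT THE d = 3 CARRIER: pairwise `3·112.25·(ε₀ + e₀)`-close,
# transported along a bond with error `3(ε₀ + e₀)·L^{−(K−n)}`, also one step outside the cell

Cell `ym3-torus` ∕ fleet seat `ym-ust-19200-p1` (gen 9; HUMAN RULING D-0037, YM ladder rung R3).  WHY.  Brick 5 of the blended-comb-gauge line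
(CARD-19200-V3-g9.md): the inputs of the blended bond estimate `Prop7BlendBond.blend_bond_le` at the T³ carrier, for a pair `W ∈ 𝔘_k(ε₀)`, `U₀ ∈ 𝔘_k(e₀)`
with the same `(K−n)`-fold (0.4)-average: at a site `x` seen from the corners `embIter (c + ε)`, `ε ∈ {0,1}³`, of a cell at relative positions `ρ_κ − ε_κL^k`
with `0 ≤ ρ_κ ≤ L^k` (the cell of `x` itself, `Prop7BlendCells.rel_corner_eq`, AND the far endpoint of a bond leaving the cell's last layer,
`rel_corner_shift_eq`), the eight comb elements `v_ε(x) = U₀(Γ_{y_ε,x})⁻¹W(Γ_{y_ε,x})` are pairwise `3·(449/4)·(ε₀ + e₀)`-close (`Prop7BlendCells` (E2) along a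
chain of ≤ 3 adjacent corners) and each is transported along the bond with error `≤ 3(ε₀ + e₀)L^{−(K−n)}` (`Prop7BlendCells` (E1), comb length `≤ 3L^k`).

WHAT IS PROVED (sorry-free, no definition).  §1 (generic torus) `rel_corner_shift_eq`, `l1_rel_le_of_formula`, `transl_update_one_eq_shift`.
§2 (carrier) `dist1_corner_adj_le_T3`, **`dist1_corner_pair_le_T3`**, **`dist1_corner_transport_le_T3`**.

HONEST SCOPE.  Bookkeeping over landed estimates; count-neutral helper toward stmt-QuantumFields-19200 (`--supports`).

References: T. Bałaban, CMP 102 (1985) 277–309 [Balaban1985Variational] ((4), (18), (145)/(151)); CMP 99 (1985) 75–102 [Balaban1985RegularSpaces]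
(Lemma 1 p.79); CMP 95 (1984) 17–40 [Balaban1984PropagatorsI] ((1.6)–(1.7) p.18).
-/

noncomputable section

namespace Summit.QuantumFields.YangMills.Theorems.Prop7BlendCorners

open scoped Matrix.Norms.L2Operator
open Literature.MathematicalPhysics.QuantumFieldTheory.Balaban1983to89
open T4Continuum BlockAveraging
open B10Eq27TorusAxialLog (axialT rel rel_apply transl transl_apply rel_shift_of_le)
open B7Prop1Explicit (l1 e e_apply)
open B7Prop1Explicit renaming Site → LSite
open B5Eq118OneStroke (iterBlockOf)
open B15DeterminingSets (embIter)
open Summit.QuantumFields.YangMills.Theorems.Prop7BlendCells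

/-! ## §1 Generic torus bookkeeping -/

section Generic

variable {P : Params} {k : ℕ}

/-- **THE FAR ENDPOINT OF A BOND, SEEN FROM THE CORNERS OF THE CELL OF ITS NEAR ENDPOINT**: `rel (embIter k (c + ε)) (z + e_μ) κ =
r_κ − ε_κ·L^k + [κ = μ]` (no wrap-around). [cite: Balaban1984PropagatorsI, (1.6)-(1.7) p.18; Balaban1987RG1, (0.1) p.252] -/
theorem rel_corner_shift_eq (hk : k ≤ P.m + P.K) (hN : 3 ≤ P.sitesPerDir k) {off : ℕ}
    (hoff : ∀ (y : Site P k) (μ : Fin P.d), ((embIter k y) μ).val = (y μ).val * P.L ^ k + off)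
    (z : Site P 0) (ε : LSite P.d) (hε : ∀ ν, ε ν = 0 ∨ ε ν = 1) (μ κ : Fin P.d) :
    rel (embIter k (transl (iterBlockOf k (transl z (fun _ => -(off : ℤ)))) ε)) (z.shift μ) κ =
      ((((transl z (fun _ => -(off : ℤ))) κ).val % P.L ^ k : ℕ) : ℤ) - ε κ * ((P.L ^ k : ℕ) : ℤ) + (if κ = μ then 1 else 0) := by
  rw [rel_shift_of_le _ _ _ (noWrap_corner hk hN hoff z ε hε μ), Pi.add_apply, e_apply, rel_corner_eq hk hN hoff z ε hε κ]

/-- If `rel y x κ = ρ_κ − ε_κ·h` with `0 ≤ ρ_κ ≤ h` and `ε ∈ {0,1}ᵈ` then `|x − y|₁ ≤ d·h`. [cite: Balaban1984PropagatorsI, (1.7) p.18] -/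
theorem l1_rel_le_of_formula {j : ℕ} (y x : Site P j) (h : ℕ) (ρ : Fin P.d → ℤ) (ε : LSite P.d) (hε : ∀ ν, ε ν = 0 ∨ ε ν = 1)
    (hρ : ∀ κ, 0 ≤ ρ κ ∧ ρ κ ≤ h) (hform : ∀ κ, rel y x κ = ρ κ - ε κ * (h : ℤ)) : l1 (rel y x) ≤ P.d * h := by
  unfold l1
  calc ∑ κ, (rel y x κ).natAbs ≤ ∑ _κ : Fin P.d, h := Finset.sum_le_sum fun κ _ => by
          rw [hform κ]
          obtain ⟨h0, h1⟩ := hρ κ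
          rcases hε κ with h0' | h1'
          · rw [h0']; omega
          · rw [h1']; omega
    _ = P.d * h := by simp

/-- Adjacent corners: `c + ε[κ ↦ 1] = (c + ε[κ ↦ 0]) + e_κ`. [cite: Balaban1987RG1, (0.1) p.251] -/
theorem transl_update_one_eq_shift (c : Site P k) (ε : LSite P.d) (κ : Fin P.d) :
    transl c (Function.update ε κ 1) = (transl c (Function.update ε κ 0)).shift κ := by
  rw [transl_shift_eq]
  congr 1
  funext ν
  by_cases hν : ν = κ
  · subst hν; simp
  · simp [hν]

/-- Updating a `{0,1}`-vector at one coordinate with `0` or `1` keeps it in `{0,1}ᵈ`. [folklore] -/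
theorem update_mem01 (ε : LSite P.d) (hε : ∀ ν, ε ν = 0 ∨ ε ν = 1) (κ : Fin P.d) (a : ℤ) (ha : a = 0 ∨ a = 1) (ν : Fin P.d) :
    Function.update ε κ a ν = 0 ∨ Function.update ε κ a ν = 1 := by
  by_cases hν : ν = κ
  · subst hν; simpa using ha
  · rw [Function.update_of_ne hν]; exact hε ν

end Generic

/-! ## §2 At the d = 3 carrier -/

section T3

open Literature.MathematicalPhysics.QuantumFieldTheory.Balaban1983to89.T3ContinuumYM3Torus
open Literature.MathematicalPhysics.QuantumFieldTheory.Balaban1983to89.T3RegularMinimiser (regThreshold)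
open Literature.MathematicalPhysics.QuantumFieldTheory.Balaban1983to89.T3PrintedRegularMinimiser (RegPr RegPr.plaqSmall)

variable (F : T3Family) (n K : ℕ)

/-- **ADJACENT CORNERS.**  `W ∈ 𝔘_k(e_W)`, `U₀ ∈ 𝔘_k(e₀)` with the same `(K−n)`-fold (0.4)-average, `L ≥ 7`, both radii small; a coarse site `c` and a fine
site `x` at relative positions `ρ_κ − ε_κL^{K−n}` (`0 ≤ ρ_κ ≤ L^{K−n}`) from every corner `embIter (c + ε)`, `ε ∈ {0,1}³`; then for `ε` with `ε_{κ₀} = 0`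
and `ε′ = ε[κ₀ ↦ 1]` the comb elements satisfy `dist1(v_ε(x)·v_{ε′}(x)⁻¹) ≤ (449/4)(e_W + e₀)`. [cite: Balaban1985RegularSpaces, Lemma 1 (1.25)-(1.26) p.79; Balaban1985Variational, (145)/(151) p.301] -/
theorem dist1_corner_adj_le_T3 (hL : 7 ≤ F.L) {eW e₀ : ℝ} (heW : 0 < eW) (he₀ : 0 < e₀)
    (hεW : 50 * (500 * (F.L : ℝ) + 7 * (F.L : ℝ) ^ 2) * eW ≤ 1) (hε₀ : 50 * (500 * (F.L : ℝ) + 7 * (F.L : ℝ) ^ 2) * e₀ ≤ 1)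
    (W U₀ : GaugeField (F.P K) 0 (Matrix.specialUnitaryGroup (Fin 2) ℂ)) (hW : RegPr F n K eW W) (hU₀ : RegPr F n K e₀ U₀)
    (hdesc : Averaging.iter (fun j => blockAvg (P := F.P K) (j := j) (ExpMeanLog.expMeanLogSU (n := Fin 2))) (K - n) W =
      Averaging.iter (fun j => blockAvg (P := F.P K) (j := j) (ExpMeanLog.expMeanLogSU (n := Fin 2))) (K - n) U₀)
    (c : Site (F.P K) (K - n)) (x : Site (F.P K) 0) (ρ : Fin (F.P K).d → ℤ) (hρ : ∀ κ, 0 ≤ ρ κ ∧ ρ κ ≤ F.L ^ (K - n))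
    (hform : ∀ ε : LSite (F.P K).d, (∀ ν, ε ν = 0 ∨ ε ν = 1) → ∀ κ,
      rel (embIter (K - n) (transl c ε)) x κ = ρ κ - ε κ * ((F.L ^ (K - n) : ℕ) : ℤ))
    (ε : LSite (F.P K).d) (hε : ∀ ν, ε ν = 0 ∨ ε ν = 1) (κ₀ : Fin (F.P K).d) (hκ₀ : ε κ₀ = 0) :
    dist1 (((axialT U₀ (embIter (K - n) (transl c ε)) x)⁻¹ * axialT W (embIter (K - n) (transl c ε)) x) *
        ((axialT U₀ (embIter (K - n) (transl c (Function.update ε κ₀ 1))) x)⁻¹ *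
          axialT W (embIter (K - n) (transl c (Function.update ε κ₀ 1))) x)⁻¹) ≤ (449 / 4) * (eW + e₀) := by
  have hd : (F.P K).d = 3 := T3Family.P_d F K
  have hε0 : Function.update ε κ₀ 0 = ε := by
    funext ν; by_cases hν : ν = κ₀
    · subst hν; simp [hκ₀]
    · rw [Function.update_of_ne hν]
  have hadj : transl c (Function.update ε κ₀ 1) = (transl c ε).shift κ₀ := by rw [transl_update_one_eq_shift, hε0]
  rw [hadj]
  have hε' : ∀ ν, Function.update ε κ₀ 1 ν = 0 ∨ Function.update ε κ₀ 1 ν = 1 := update_mem01 ε hε κ₀ 1 (Or.inr rfl)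
  refine dist1_combElem_mul_inv_le_T3 F n K hL heW he₀ hεW hε₀ W U₀ hW hU₀ hdesc (transl c ε) κ₀ x ?_ ?_ ?_
  · intro κ
    rw [← hadj, hform ε hε κ, hform _ hε' κ]
    by_cases hκ : κ₀ = κ
    · subst hκ; simp [hκ₀]
    · rw [Function.update_of_ne (Ne.symm hκ), if_neg hκ]; ring
  · exact l1_rel_le_of_formula _ x (F.L ^ (K - n)) ρ ε hε hρ (hform ε hε)
  · rw [← hadj]
    exact l1_rel_le_of_formula _ x (F.L ^ (K - n)) ρ _ hε' hρ (hform _ hε')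

/-- **ANY TWO CORNERS** (chain through at most three adjacent pairs; d = 3): `dist1(v_ε(x)·v_{ε′}(x)⁻¹) ≤ 3·(449/4)(e_W + e₀)` for all
`ε, ε′ ∈ {0,1}³`. [cite: Balaban1985RegularSpaces, Lemma 1 (1.25)-(1.26) p.79; Balaban1985Variational, (145)/(151) p.301] -/
theorem dist1_corner_pair_le_T3 (hL : 7 ≤ F.L) {eW e₀ : ℝ} (heW : 0 < eW) (he₀ : 0 < e₀)
    (hεW : 50 * (500 * (F.L : ℝ) + 7 * (F.L : ℝ) ^ 2) * eW ≤ 1) (hε₀ : 50 * (500 * (F.L : ℝ) + 7 * (F.L : ℝ) ^ 2) * e₀ ≤ 1)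
    (W U₀ : GaugeField (F.P K) 0 (Matrix.specialUnitaryGroup (Fin 2) ℂ)) (hW : RegPr F n K eW W) (hU₀ : RegPr F n K e₀ U₀)
    (hdesc : Averaging.iter (fun j => blockAvg (P := F.P K) (j := j) (ExpMeanLog.expMeanLogSU (n := Fin 2))) (K - n) W =
      Averaging.iter (fun j => blockAvg (P := F.P K) (j := j) (ExpMeanLog.expMeanLogSU (n := Fin 2))) (K - n) U₀)
    (c : Site (F.P K) (K - n)) (x : Site (F.P K) 0) (ρ : Fin (F.P K).d → ℤ) (hρ : ∀ κ, 0 ≤ ρ κ ∧ ρ κ ≤ F.L ^ (K - n))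
    (hform : ∀ ε : LSite (F.P K).d, (∀ ν, ε ν = 0 ∨ ε ν = 1) → ∀ κ,
      rel (embIter (K - n) (transl c ε)) x κ = ρ κ - ε κ * ((F.L ^ (K - n) : ℕ) : ℤ))
    (ε ε' : LSite (F.P K).d) (hε : ∀ ν, ε ν = 0 ∨ ε ν = 1) (hε' : ∀ ν, ε' ν = 0 ∨ ε' ν = 1) :
    dist1 (((axialT U₀ (embIter (K - n) (transl c ε)) x)⁻¹ * axialT W (embIter (K - n) (transl c ε)) x) *
        ((axialT U₀ (embIter (K - n) (transl c ε')) x)⁻¹ * axialT W (embIter (K - n) (transl c ε')) x)⁻¹) ≤ 3 * ((449 / 4) * (eW + e₀)) := by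
  have hd : (F.P K).d = 3 := T3Family.P_d F K
  -- one coordinate: `dist1(v_ε v_{ε[κ ↦ a]}⁻¹) ≤ (449/4)(eW+e₀)` for `ε ∈ {0,1}³`, `a ∈ {0,1}`
  have hD0 : 0 ≤ (449 / 4) * (eW + e₀) := by positivity
  have step : ∀ (ε : LSite (F.P K).d), (∀ ν, ε ν = 0 ∨ ε ν = 1) → ∀ (κ : Fin (F.P K).d) (a : ℤ), (a = 0 ∨ a = 1) →
      dist1 (((axialT U₀ (embIter (K - n) (transl c ε)) x)⁻¹ * axialT W (embIter (K - n) (transl c ε)) x) *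
        ((axialT U₀ (embIter (K - n) (transl c (Function.update ε κ a))) x)⁻¹ *
          axialT W (embIter (K - n) (transl c (Function.update ε κ a))) x)⁻¹) ≤ (449 / 4) * (eW + e₀) := by
    intro ε hε κ a ha
    rcases hε κ with h0 | h1
    · rcases ha with ha0 | ha1
      · subst ha0
        have : Function.update ε κ 0 = ε := by
          funext ν; by_cases hν : ν = κ
          · subst hν; simp [h0]
          · rw [Function.update_of_ne hν]
        rw [this, mul_inv_cancel, GaugeGroup.dist1_one]; exact hD0
      · subst ha1
        exact dist1_corner_adj_le_T3 F n K hL heW he₀ hεW hε₀ W U₀ hW hU₀ hdesc c x ρ hρ hform ε hε κ h0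
    · rcases ha with ha0 | ha1
      · subst ha0
        -- `ε = ε₀[κ ↦ 1]` with `ε₀ = ε[κ ↦ 0]`: the adjacent bound read backwards
        set εz : LSite (F.P K).d := Function.update ε κ 0 with hεzdef
        have hεzm : ∀ ν, εz ν = 0 ∨ εz ν = 1 := update_mem01 ε hε κ 0 (Or.inl rfl)
        have hback : Function.update εz κ 1 = ε := by
          funext ν; by_cases hν : ν = κ
          · subst hν; simp [hεzdef, h1]
          · rw [Function.update_of_ne hν, hεzdef, Function.update_of_ne hν]
        have h := dist1_corner_adj_le_T3 F n K hL heW he₀ hεW hε₀ W U₀ hW hU₀ hdesc c x ρ hρ hform εz hεzm κ (by simp [hεzdef])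
        rw [hback] at h
        rwa [← GaugeGroup.dist1_inv, mul_inv_rev, inv_inv]
      · subst ha1
        have : Function.update ε κ 1 = ε := by
          funext ν; by_cases hν : ν = κ
          · subst hν; simp [h1]
          · rw [Function.update_of_ne hν]
        rw [this, mul_inv_cancel, GaugeGroup.dist1_one]; exact hD0
  -- the chain `ε → ε[0 ↦ ε′₀] → ε[0 ↦ ε′₀][1 ↦ ε′₁] → ε′`
  obtain ⟨κ0, κ1, κ2, hκ⟩ : ∃ κ0 κ1 κ2 : Fin (F.P K).d, ∀ ν : Fin (F.P K).d, ν = κ0 ∨ ν = κ1 ∨ ν = κ2 := by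
    refine ⟨⟨0, by omega⟩, ⟨1, by omega⟩, ⟨2, by omega⟩, fun ν => ?_⟩
    have := ν.isLt
    rcases ν with ⟨v, hv⟩
    have : v = 0 ∨ v = 1 ∨ v = 2 := by omega
    rcases this with h | h | h
    · left; exact Fin.ext h
    · right; left; exact Fin.ext h
    · right; right; exact Fin.ext h
  set ε₁ : LSite (F.P K).d := Function.update ε κ0 (ε' κ0) with hε₁
  set ε₂ : LSite (F.P K).d := Function.update ε₁ κ1 (ε' κ1) with hε₂
  set ε₃ : LSite (F.P K).d := Function.update ε₂ κ2 (ε' κ2) with hε₃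
  have hε₁m : ∀ ν, ε₁ ν = 0 ∨ ε₁ ν = 1 := update_mem01 ε hε κ0 _ (hε' κ0)
  have hε₂m : ∀ ν, ε₂ ν = 0 ∨ ε₂ ν = 1 := update_mem01 ε₁ hε₁m κ1 _ (hε' κ1)
  have hε₃ε' : ε₃ = ε' := by
    funext ν
    rcases hκ ν with h | h | h <;> rw [h]
    · simp only [hε₃, hε₂, hε₁]
      by_cases h2 : κ0 = κ2
      · rw [h2, Function.update_self]
      · rw [Function.update_of_ne h2]
        by_cases h1' : κ0 = κ1
        · rw [h1', Function.update_self]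
        · rw [Function.update_of_ne h1', Function.update_self]
    · simp only [hε₃, hε₂]
      by_cases h2 : κ1 = κ2
      · rw [h2, Function.update_self]
      · rw [Function.update_of_ne h2, Function.update_self]
    · simp only [hε₃, Function.update_self]
  set vE : LSite (F.P K).d → Matrix.specialUnitaryGroup (Fin 2) ℂ :=
    fun δ => (axialT U₀ (embIter (K - n) (transl c δ)) x)⁻¹ * axialT W (embIter (K - n) (transl c δ)) x with hvE
  have s1 : dist1 (vE ε * (vE ε₁)⁻¹) ≤ (449 / 4) * (eW + e₀) := step ε hε κ0 _ (hε' κ0)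
  have s2 : dist1 (vE ε₁ * (vE ε₂)⁻¹) ≤ (449 / 4) * (eW + e₀) := step ε₁ hε₁m κ1 _ (hε' κ1)
  have s3 : dist1 (vE ε₂ * (vE ε₃)⁻¹) ≤ (449 / 4) * (eW + e₀) := step ε₂ hε₂m κ2 _ (hε' κ2)
  rw [hε₃ε'] at s3
  have hsplit : vE ε * (vE ε')⁻¹ = (vE ε * (vE ε₁)⁻¹) * ((vE ε₁ * (vE ε₂)⁻¹) * (vE ε₂ * (vE ε')⁻¹)) := by group
  show dist1 (vE ε * (vE ε')⁻¹) ≤ _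
  rw [hsplit]
  calc dist1 ((vE ε * (vE ε₁)⁻¹) * ((vE ε₁ * (vE ε₂)⁻¹) * (vE ε₂ * (vE ε')⁻¹)))
      ≤ dist1 (vE ε * (vE ε₁)⁻¹) + dist1 ((vE ε₁ * (vE ε₂)⁻¹) * (vE ε₂ * (vE ε')⁻¹)) := GaugeGroup.dist1_mul_le _ _
    _ ≤ dist1 (vE ε * (vE ε₁)⁻¹) + (dist1 (vE ε₁ * (vE ε₂)⁻¹) + dist1 (vE ε₂ * (vE ε')⁻¹)) := by
        gcongr; exact GaugeGroup.dist1_mul_le _ _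
    _ ≤ 3 * ((449 / 4) * (eW + e₀)) := by linarith

/-- **TRANSPORT OF A CORNER ELEMENT ALONG A BOND OF THE CELL**: `W ∈ 𝔘_k(e_W)`, `U₀ ∈ 𝔘_k(e₀)`, at least three blocks per direction; for the cell of `z`
(uniform centre offset `off`) and any corner `ε ∈ {0,1}³`, the bond `b = ⟨z, μ⟩`:
`dist1(v_ε(z)·W_b·v_ε(z + e_μ)⁻¹·U₀,b⁻¹) ≤ 3(e_W + e₀)·L^{−(K−n)}`. [cite: Balaban1985RegularSpaces, Lemma 1 (1.25) p.79] -/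
theorem dist1_corner_transport_le_T3 (hk : K - n ≤ (F.P K).m + (F.P K).K) (hN : 3 ≤ (F.P K).sitesPerDir (K - n)) {off : ℕ}
    (hoff : ∀ (y : Site (F.P K) (K - n)) (μ : Fin (F.P K).d), ((embIter (K - n) y) μ).val = (y μ).val * (F.P K).L ^ (K - n) + off)
    {eW e₀ : ℝ} (heW : 0 ≤ eW) (he₀ : 0 ≤ e₀)
    (W U₀ : GaugeField (F.P K) 0 (Matrix.specialUnitaryGroup (Fin 2) ℂ)) (hW : RegPr F n K eW W) (hU₀ : RegPr F n K e₀ U₀)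
    (z : Site (F.P K) 0) (ε : LSite (F.P K).d) (hε : ∀ ν, ε ν = 0 ∨ ε ν = 1) (μ : Fin (F.P K).d) :
    dist1 (((axialT U₀ (embIter (K - n) (transl (iterBlockOf (K - n) (transl z (fun _ => -(off : ℤ)))) ε)) z)⁻¹ *
          axialT W (embIter (K - n) (transl (iterBlockOf (K - n) (transl z (fun _ => -(off : ℤ)))) ε)) z) * W ⟨z, μ⟩ *
        (((axialT U₀ (embIter (K - n) (transl (iterBlockOf (K - n) (transl z (fun _ => -(off : ℤ)))) ε)) (z.shift μ))⁻¹ *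
          axialT W (embIter (K - n) (transl (iterBlockOf (K - n) (transl z (fun _ => -(off : ℤ)))) ε)) (z.shift μ)))⁻¹ * (U₀ ⟨z, μ⟩)⁻¹) ≤
      3 * (eW + e₀) * (((F.L : ℝ))⁻¹) ^ (K - n) := by
  have hpos : 0 ≤ (((F.L : ℝ))⁻¹) ^ (2 * (K - n)) := pow_nonneg (inv_nonneg.mpr (Nat.cast_nonneg _)) _
  have h := dist1_combElem_transport_le W U₀ (mul_nonneg heW hpos) (mul_nonneg he₀ hpos) (RegPr.plaqSmall hW) (RegPr.plaqSmall hU₀)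
    (embIter (K - n) (transl (iterBlockOf (K - n) (transl z (fun _ => -(off : ℤ)))) ε)) z μ (noWrap_corner hk hN hoff z ε hε μ)
  refine h.trans ?_
  have hl : l1 (rel (embIter (K - n) (transl (iterBlockOf (K - n) (transl z (fun _ => -(off : ℤ)))) ε)) z) ≤ 3 * F.L ^ (K - n) :=
    l1_rel_corner_le hk hN hoff z ε hε
  have hl' : (l1 (rel (embIter (K - n) (transl (iterBlockOf (K - n) (transl z (fun _ => -(off : ℤ)))) ε)) z) : ℝ) ≤ 3 * (F.L : ℝ) ^ (K - n) := by
    exact_mod_cast hl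
  have hL0 : (0 : ℝ) < (F.L : ℝ) := by exact_mod_cast F.hL.2.le.trans_lt' (by norm_num)
  have hsum : 0 ≤ eW + e₀ := by linarith
  have hkey : 3 * (F.L : ℝ) ^ (K - n) * ((eW + e₀) * (((F.L : ℝ))⁻¹) ^ (2 * (K - n))) = 3 * (eW + e₀) * (((F.L : ℝ))⁻¹) ^ (K - n) := by
    have : (F.L : ℝ) ^ (K - n) * (((F.L : ℝ))⁻¹) ^ (2 * (K - n)) = (((F.L : ℝ))⁻¹) ^ (K - n) := by
      rw [two_mul, pow_add, ← mul_assoc, ← mul_pow, mul_inv_cancel₀ hL0.ne', one_pow, one_mul]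
    calc 3 * (F.L : ℝ) ^ (K - n) * ((eW + e₀) * (((F.L : ℝ))⁻¹) ^ (2 * (K - n)))
        = 3 * (eW + e₀) * ((F.L : ℝ) ^ (K - n) * (((F.L : ℝ))⁻¹) ^ (2 * (K - n))) := by ring
      _ = 3 * (eW + e₀) * (((F.L : ℝ))⁻¹) ^ (K - n) := by rw [this]
  calc (l1 (rel (embIter (K - n) (transl (iterBlockOf (K - n) (transl z (fun _ => -(off : ℤ)))) ε)) z) : ℝ) *
        (eW * (((F.L : ℝ))⁻¹) ^ (2 * (K - n)) + e₀ * (((F.L : ℝ))⁻¹) ^ (2 * (K - n)))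
      = (l1 (rel (embIter (K - n) (transl (iterBlockOf (K - n) (transl z (fun _ => -(off : ℤ)))) ε)) z) : ℝ) *
        ((eW + e₀) * (((F.L : ℝ))⁻¹) ^ (2 * (K - n))) := by ring
    _ ≤ 3 * (F.L : ℝ) ^ (K - n) * ((eW + e₀) * (((F.L : ℝ))⁻¹) ^ (2 * (K - n))) :=
        mul_le_mul_of_nonneg_right hl' (mul_nonneg hsum hpos)
    _ = 3 * (eW + e₀) * (((F.L : ℝ))⁻¹) ^ (K - n) := hkey

end T3

end Summit.QuantumFields.YangMills.Theorems.Prop7BlendCorners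

end
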